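import Summits.QuantumFields.YangMills.Theorems.BalabanUVNodesN16Thm1AtTorusVPSmallCubesRankN
import Summits.QuantumFields.YangMills.Theorems.BalabanUVNodesN16H7OfReg9
import Summits.QuantumFields.BalabanUV.T4Continuum.Support.MinimalActionFromThm1KDatum
import HarnessLib
/-!
# Route «BalabanUVNodes» (K3⁷ `SpineGivenEndpointR13SepCoPH`, stmt-QuantumFields-20544), DAG node N16 = NE3, in-edge N07 → N16 — THE SMALL-CUBE VACUITY IN EVERY RANK, PART 2:
# the parent's own (9)_{β₀=1} gauge shape (NO hypothesis left), the record's letters for every `[NeZero N]`, and the negation VERBATIM of `stub_thm1At` of the N16 discharge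
# test v5 for EVERY `N ≥ 1` (dag-n16-w2's `N16Thm1AtTorusVPSmallCubes.not_stub_thm1At` is the case `N = 2`)

Cell `pub-ymgap`, width seat `pub-ymgap-dag-n16-w5` (director-ym R399 (3a); dag-n16-w2 g4's OFFER (o3), INBOX l.29714∕l.29847), generation 0.  `--kind proof --supports
stmt-QuantumFields-20544 --as helper` (count-neutral).  `bears_on: R4∕N16 · edge N07 → N16`.  Part 1: `Theorems/BalabanUVNodesN16Thm1AtTorusVPSmallCubesRankN.lean` (this seat):
`not_forall_thm1At_torusVP_rankN` — for every nonempty fintype `n`, `d ≥ 2`, `L ≥ 2`, torus factor `N ≥ 2`, every `C`, every radii-monotone `G` with the first-order interface,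
`¬ ∀ k, Thm1At C (torusVP d L N G (k+1))`.

WHAT THIS FILE PROVES (0 `def`, 0 `sorry`).  §1 ★★ `not_forall_thm1At_torusVP_lipGauge_rankN`: for the parent's (9)_{β₀=1} sup shape on cubes (written out as in
`N16H7OfReg9.radiiMono_lipGauge`), whose interface binders HOLD (`radiiMono_lipGauge ∕ interface_lipGauge`, the parent's A6 inhabitants), NOTHING is left to assume:
`¬ ∀ k, Thm1At C (torusVP d L N G₉ (k+1))` for every `C`, every nonempty `n`, `d ≥ 2`, `L ≥ 2`, `N ≥ 2`.  §2 at the record's letters (`d = 4`, `L = F.L > 1`, period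
`ne3NperOfRecord₁₁ F 0 0 ≥ 2`, `MatA N`, any `[NeZero N]`): `not_forall_thm1At_torusVP_record_rankN` (binders VERBATIM those of `N16PinnedLayer13CoPH` §4 ∕ `N16PinnedLooseMatch` — five-clause
interface, projected to first order inside); `not_forall_family_thm1At_torusVP_record` — there is NO family-indexed assignment `F ↦ (G F, C F)` inhabiting ⟨`hGm`, `hG`, `hT`⟩ (`T4Family` is
inhabited: `L = 13`, `m = 1`); ★★ `not_stub_thm1At_rankN (F : T4Family)` = `¬ (∃ G C, RadiiMono ∧ interface ∧ (∀ e, … → 7∕2 ≤ C.Mfun e) ∧ ∀ k, Thm1At C (torusVP 4 F.L (ne3NperOfRecord₁₁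
F 0 0) G (k+1)))` — STUB 2 of dag-n16-e's evidence file `N16DischargeTestV5.lean` negated VERBATIM, for EVERY `N ≥ 1`.  §3 ★ `not_forall_thm1At_torusVP_expGauge_rankN`: the same for row
NE3-R2's `AveragingDeficitKDatum.ExpGauge` shape in every rank — the `hThm` binder of leaf-06's END `MinimalActionFromThm1KDatum.upperData_of_thm1At_expGauge` ∕
`exists_tendsto_minAct_of_thm1At_expGauge` (cell pub-balaban, NE3 route (A)) is uninhabited for every `U(N)` (dag-n16-w2: `n = Fin 2`).

CONSEQUENCE ∕ CAUSE ∕ REPAIR: Part 1's header and dag-n16-w2's `…SmallCubes` header (A6 vacuity of the (β16) loose-road producers' Thm-1 binder — now rank-independent; leaf-06 D-s3-3;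
repair C′ = print's cube class, e.g. `1 ≤ sizeM c`).

HONEST FRAMING.  Kernel facts BY NAME over Part 1 and the parent; 0 `def`, 0 `sorry`.  [Balaban1985Variational] Theorem 1 AS PRINTED neither refuted nor proved; no registered stub of
K3⁷ v5 named; N16 ∕ N07 NOT discharged; count-neutral (typed 28∕28 · discharged 5∕27 · A 5∕28 unmoved); one finite four-torus at fixed `ε` — NOT ℝ⁴, NOT infinite volume, NOT OS, NOT a
mass gap; the YM mass gap (Clay) is NOT proved (nor disproved) by any of this — R4 closes the conditional finite-𝕋⁴ rung `BalabanLadder.UV` only.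
-/

set_option autoImplicit false

open scoped BigOperators Matrix Matrix.Norms.L2Operator
open NormedSpace

namespace Summit.QuantumFields.YangMills.BalabanUVNodes.N16Thm1AtTorusVPSmallCubesRankNRecord

open Literature.MathematicalPhysics.QuantumFieldTheory.Balaban1983to89
open B7Prop1Explicit B7Prop2Explicit MatrixLog UnitaryModel
open T4AveragingDeficitWall hiding Site Plane Plaq Bond
open Summit.QuantumFields.BalabanUV.T4Continuum
open AveragingDeficitLatticeH2Prep (fd)
open MinimalActionDictionary (torusVP RadiiMono)
open B11Thm1 (Thm1At)
open T4Continuum (T4Family)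
open Node00 (ne3NperOfRecord₁₁ two_le_ne3NperOfRecord₁₁ MatA)
open Summit.QuantumFields.YangMills.BalabanUVNodes.N16Thm1AtTorusVPSmallCubesRankN (not_forall_thm1At_torusVP_rankN)

noncomputable section

variable {d : ℕ} {n : Type} [Fintype n] [DecidableEq n]

/-! ## §1 The parent's own gauge shape: no hypothesis left -/
/-- **★★ THE CONCRETE SHAPE OF THE PARENT: NO HYPOTHESES LEFT.**  For the (9)_{β₀=1} sup shape on cubes `box K y` («a unitary gauge `u` and a potential `a` with `U^u = exp a`,
`‖a‖ ≤ α₀`, `‖∇a‖ ≤ α₁`, `‖∇∇a‖ ≤ α₂` on `box K y`»), whose interface binders HOLD (`N16H7OfReg9.radiiMono_lipGauge` ∕ `interface_lipGauge` — the parent's A6 inhabitants), Theorem 1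
at the torus instances of all runs is FALSE outright: `¬ ∀ k, Thm1At C (torusVP d L N G₉ (k+1))` for every `C`, `d ≥ 2`, `L ≥ 2`, `N ≥ 2`, `U(N)`.  So at the parent's own
displayed inhabitant of `hGm`∕`hG` the remaining binder `hT` is unsatisfiable — the kernel form of «the N07 → N16 edge in leaf-06's Thm-1 currency cannot be supplied AS TYPED».
[folklore] -/
theorem not_forall_thm1At_torusVP_lipGauge_rankN [Nonempty n] (hd : 2 ≤ d) {L N : ℕ} (hL : 2 ≤ L) (hN : 2 ≤ N) (C : B11Thm1.Consts) :
    ¬ ∀ k : ℕ, Thm1At C (torusVP d L N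
      (fun (U : Site d → Fin d → (Matrix n n ℂ)ˣ) (y : Site d) (K : ℕ) (α₀ α₁ α₂ : ℝ) =>
        ∃ (u : Site d → (Matrix n n ℂ)ˣ) (a : Site d → Fin d → Matrix n n ℂ), (∀ z, u z ∈ unitaryUnits (Matrix n n ℂ)) ∧
          (∀ (z : Site d) (τ : Fin d), z ∈ box K y → ((gaugeAct u U z τ : (Matrix n n ℂ)ˣ) : Matrix n n ℂ) = exp (a z τ)) ∧
          (∀ (z : Site d) (τ : Fin d), z ∈ box K y → ‖a z τ‖ ≤ α₀) ∧
          (∀ (z : Site d) (τ i : Fin d), z ∈ box K y → ‖fd i (fun w => a w τ) z‖ ≤ α₁) ∧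
          (∀ (z : Site d) (τ i l : Fin d), z ∈ box K y → ‖fd i (fd l (fun w => a w τ)) z‖ ≤ α₂)) (k + 1)) :=
  not_forall_thm1At_torusVP_rankN hd hL hN N16H7OfReg9.radiiMono_lipGauge
    (fun U x K α₀ α₁ α₂ hK h => by
      obtain ⟨u, a, hu, he, h0, h1, -⟩ := N16H7OfReg9.interface_lipGauge U x K α₀ α₁ α₂ hK h
      exact ⟨u, a, hu, he, h0, h1⟩) C

/-! ## §2 At the record's letters (d = 4, `L = F.L`, period `ne3NperOfRecord₁₁ F 0 0`, `M_N(ℂ)`): the N16 producers' Thm-1 binder block is uninhabited -/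

/-- **AT THE RECORD: `¬ ∀ k, Thm1At C (torusVP 4 F.L (ne3NperOfRecord₁₁ F 0 0) G (k+1))`** for every family `F` (`F.L > 1`, period `2L^m ≥ 2`), every `N ≥ 1`, every shape `G` with the
interface binders — the binder triple ⟨`hGm F`, `hG F`, `hT F`⟩ of `N16PinnedLayer13CoPH.exists_letters_n16HolderAtReading_loose_of_h5_thm1At` (module 43 §4, the BY-NAME producer of K3⁷
v5's N16 pin conjuncts), of `N16PinnedLooseMatch` (module 45) and of `N16H7LooseOfThm1At` ∕ `N16LettersOfLettersB9SrcAllTorus` ∕ `N16PinnedLooseMatchOfLettersB9Src` is unsatisfiable at each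
`F`. [folklore] -/
theorem not_forall_thm1At_torusVP_record_rankN {N : ℕ} [NeZero N] (F : T4Family)
    {G : (Site 4 → Fin 4 → (MatA N)ˣ) → Site 4 → ℕ → ℝ → ℝ → ℝ → Prop} (hGm : RadiiMono 4 G)
    (hG : ∀ (U : Site 4 → Fin 4 → (MatA N)ˣ) (x : Site 4) (K : ℕ) (α₀ α₁ α₂ : ℝ), 2 ≤ K → G U x K α₀ α₁ α₂ →
      ∃ (u : Site 4 → (MatA N)ˣ) (a : Site 4 → Fin 4 → MatA N),
        (∀ z, u z ∈ unitaryUnits (MatA N)) ∧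
        (∀ (y : Site 4) (τ : Fin 4), l1 (y - x) ≤ 2 → ((gaugeAct u U y τ : (MatA N)ˣ) : MatA N) = exp (a y τ)) ∧
        (∀ (y : Site 4) (τ : Fin 4), l1 (y - x) ≤ 2 → ‖a y τ‖ ≤ α₀) ∧
        (∀ (y : Site 4) (τ i : Fin 4), l1 (y - x) ≤ 1 → ‖fd i (fun z => a z τ) y‖ ≤ α₁) ∧
        (∀ (τ i l : Fin 4), ‖fd i (fd l (fun z => a z τ)) x‖ ≤ α₂))
    (C : B11Thm1.Consts) :
    ¬ ∀ k : ℕ, Thm1At C (torusVP 4 F.L (ne3NperOfRecord₁₁ F 0 0) G (k + 1)) :=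
  not_forall_thm1At_torusVP_rankN (n := Fin N) (by norm_num) F.hL.2 (two_le_ne3NperOfRecord₁₁ F 0 0) hGm
    (fun U x K α₀ α₁ α₂ hK h => by
      obtain ⟨u, a, hu, he, h0, h1, -⟩ := hG U x K α₀ α₁ α₂ hK h
      exact ⟨u, a, hu, he, h0, h1⟩) C

/-- **THE FAMILY-INDEXED BINDER BLOCK IS UNINHABITED**: there is no assignment `F ↦ (G F, C F)` with `hGm`, `hG` and `hT : ∀ F k, Thm1At (C F) (torusVP 4 F.L (ne3NperOfRecord₁₁ F 0 0) (G F) (k+1))`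
(`T4Family` is inhabited: `L = 13`, `m = 1`).  These are, verbatim, three of the five displayed binders of module 43 §4 ∕ module 45 ∕ `N16DischargeTestV5.n16_share_of_stub1_v5`'s road. [folklore] -/
theorem not_forall_family_thm1At_torusVP_record {N : ℕ} [NeZero N]
    {G : T4Family → (Site 4 → Fin 4 → (MatA N)ˣ) → Site 4 → ℕ → ℝ → ℝ → ℝ → Prop} (hGm : ∀ F, RadiiMono 4 (G F))
    (hG : ∀ (F : T4Family) (U : Site 4 → Fin 4 → (MatA N)ˣ) (x : Site 4) (K : ℕ) (α₀ α₁ α₂ : ℝ), 2 ≤ K → G F U x K α₀ α₁ α₂ →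
      ∃ (u : Site 4 → (MatA N)ˣ) (a : Site 4 → Fin 4 → MatA N),
        (∀ z, u z ∈ unitaryUnits (MatA N)) ∧
        (∀ (y : Site 4) (τ : Fin 4), l1 (y - x) ≤ 2 → ((gaugeAct u U y τ : (MatA N)ˣ) : MatA N) = exp (a y τ)) ∧
        (∀ (y : Site 4) (τ : Fin 4), l1 (y - x) ≤ 2 → ‖a y τ‖ ≤ α₀) ∧
        (∀ (y : Site 4) (τ i : Fin 4), l1 (y - x) ≤ 1 → ‖fd i (fun z => a z τ) y‖ ≤ α₁) ∧
        (∀ (τ i l : Fin 4), ‖fd i (fd l (fun z => a z τ)) x‖ ≤ α₂))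
    (C : T4Family → B11Thm1.Consts) :
    ¬ ∀ (F : T4Family) (k : ℕ), Thm1At (C F) (torusVP 4 F.L (ne3NperOfRecord₁₁ F 0 0) (G F) (k + 1)) := by
  intro h
  let F₀ : T4Family := ⟨13, ⟨by decide, by norm_num⟩, by norm_num, 1, le_rfl⟩
  exact not_forall_thm1At_torusVP_record_rankN F₀ (hGm F₀) (hG F₀) (C F₀) (h F₀)

/-- **`stub_thm1At` OF THE N16 DISCHARGE TEST v5 IS FALSE AS STATED** (evidence file `N16DischargeTestV5.lean` on stmt-QuantumFields-20544, dag-n16-e g16, STUB 2: «∃ G C, RadiiMono ∧ interface ∧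
`M(e) ≥ 7∕2` ∧ ∀ k, Thm1At C (torusVP 4 F.L (ne3NperOfRecord₁₁ F 0 0) G (k+1))»): its body has NO witness, for every family `F` and every `N ≥ 1` — so the v5 burn-down «N16 ⟸ stub_h5 ∧
stub_thm1At» reads N16 from a false stub, and the N07 → N16 edge needs a re-typed Thm-1 currency (cube family of print's class) before it can be supplied. [folklore] -/
theorem not_stub_thm1At_rankN {N : ℕ} [NeZero N] (F : T4Family) :
    ¬ ∃ (G : (Site 4 → Fin 4 → (MatA N)ˣ) → Site 4 → ℕ → ℝ → ℝ → ℝ → Prop) (C : B11Thm1.Consts), RadiiMono 4 G ∧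
      (∀ (U : Site 4 → Fin 4 → (MatA N)ˣ) (x : Site 4) (K : ℕ) (α₀ α₁ α₂ : ℝ), 2 ≤ K → G U x K α₀ α₁ α₂ →
      ∃ (u : Site 4 → (MatA N)ˣ) (a : Site 4 → Fin 4 → MatA N),
        (∀ z, u z ∈ unitaryUnits (MatA N)) ∧
        (∀ (y : Site 4) (τ : Fin 4), l1 (y - x) ≤ 2 → ((gaugeAct u U y τ : (MatA N)ˣ) : MatA N) = exp (a y τ)) ∧
        (∀ (y : Site 4) (τ : Fin 4), l1 (y - x) ≤ 2 → ‖a y τ‖ ≤ α₀) ∧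
        (∀ (y : Site 4) (τ i : Fin 4), l1 (y - x) ≤ 1 → ‖fd i (fun z => a z τ) y‖ ≤ α₁) ∧
        (∀ (τ i l : Fin 4), ‖fd i (fd l (fun z => a z τ)) x‖ ≤ α₂)) ∧
      (∀ e : ℝ, 0 < e → e ≤ C.a₁ → 7 / 2 ≤ C.Mfun e) ∧
      (∀ k : ℕ, Thm1At C (torusVP 4 F.L (ne3NperOfRecord₁₁ F 0 0) G (k + 1))) := by
  rintro ⟨G, C, hGm, hG, -, hT⟩
  exact not_forall_thm1At_torusVP_record_rankN F hGm hG C hT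


/-! ## §3 Row NE3-R2's `ExpGauge` shape: leaf-06's END binder `hThm` is uninhabited in every rank -/

section ExpGaugeShape

open AveragingDeficitKDatum (ExpGauge)
open MinimalActionFromThm1KDatum (radiiMono_expGauge)

/-- **`∀ k, Thm1At C (torusVP d L N (ExpGauge d) (k+1))` IS FALSE IN EVERY RANK** (any nonempty `n`, `d ≥ 2`, `L ≥ 2`, torus factor `N ≥ 2`, any `C`): row NE3-R2's exponential-gauge
shape `AveragingDeficitKDatum.ExpGauge` supplies the first-order interface at every cube `K ≥ 2` (sites within `|·|₁ ≤ 2` of the centre lie in `box K y`) and is radii-monotone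
(`radiiMono_expGauge`); so the hypothesis `hThm` of leaf-06's END `MinimalActionFromThm1KDatum.upperData_of_thm1At_expGauge` ∕ `exists_tendsto_minAct_of_thm1At_expGauge` is uninhabited
for EVERY `U(N)` (dag-n16-w2's `N16Thm1AtTorusVPSmallCubes.not_forall_thm1At_torusVP_expGauge` is the case `n = Fin 2`, any torus factor).  The same located reading D-s3-3 — not a
statement about print's Theorem 1. [cite: Balaban1985Variational, Thm 1 (8)–(10) p.279] -/
theorem not_forall_thm1At_torusVP_expGauge_rankN [Nonempty n] (hd : 2 ≤ d) {L N : ℕ} (hL : 2 ≤ L) (hN : 2 ≤ N) (C : B11Thm1.Consts) :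
    ¬ ∀ k : ℕ, Thm1At C (torusVP d L N (ExpGauge (n := n) d) (k + 1)) := by
  refine not_forall_thm1At_torusVP_rankN hd hL hN radiiMono_expGauge (fun U x K α₀ α₁ α₂ hK hGU => ?_) C
  obtain ⟨u, a, hu, he, h0, h1, -⟩ := hGU
  have hbox : ∀ {y : Site d} {m : ℕ}, l1 (y - x) ≤ m → m ≤ K → y ∈ box K x := fun {y m} hy hm =>
    AveragingDeficitCounting.box_mono (by omega) x
      (AveragingDeficitKDatum.mem_box_add_of_l1 (AveragingDeficitCounting.self_mem_box 0 x) hy)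
  exact ⟨u, a, hu, fun y τ hy => he y τ (hbox hy hK), fun y τ hy => h0 y τ (hbox hy hK),
    fun y τ i hy => h1 y τ i (hbox hy (le_trans (by norm_num) hK))⟩

end ExpGaugeShape

end

end Summit.QuantumFields.YangMills.BalabanUVNodes.N16Thm1AtTorusVPSmallCubesRankNRecord
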